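import Literature.Probability.LatticeModels.GriffithsMonotonicity
import Literature.Probability.LatticeModels.GibbsSpecificationProofs
import Literature.Probability.LatticeModels.GibbsSpecificationDLRProofs
import HarnessLib

/-!
# Covariance of the Ising finite-volume measures and Gibbs measures under graph automorphisms

Topic `Probability/LatticeModels`. Georgii–Higuchi 2000, §2 (p. 3): "We will also use a class of
transformations of `Ω` which preserve the Ising Hamiltonian, and thereby the class `𝒢` of Gibbs
measures. These transformations are the spin-flip …, the translations …, and the reflections in
lines `ℓ` through lattice sites … All these reflections act canonically on `Ω`." This file treats
all **graph automorphisms** `φ : G ≃g G` of a locally finite graph at once (translations,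
reflections and rotations of `ℤ^d` included); the spin flip is `IsingGibbsFlip`.

* `configRelabel φ` — the action `(R_φ σ)(y) = σ(φ⁻¹ y)` of a bijection of sites on configurations,
  a measurable equivalence (Mathlib `MeasurableEquiv.arrowCongr'`; for `φ = Site.shift v` this is
  the tree's `configShift v`);
* `isingHamiltonian_fixed_relabel`, `isingExpect_fixed_relabel`, `isingMeasure_fixed_map_relabel`
  — `μ^{R_φ η}_{φ(Λ);β,h} = μ^η_{Λ;β,h} ∘ R_φ⁻¹` (Friedli–Velenik 2017, §3.1 with Exercise 6.21:
  the Ising specification is invariant under the lattice symmetries);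
* `isingSpecification_relabel_apply`, **`IsGibbsMeasure.map_configRelabel`** — `𝒢(β, h)` is
  invariant: `μ ∈ 𝒢 ⇒ μ ∘ R_φ⁻¹ ∈ 𝒢` (Georgii 2011, §5.1 / Georgii–Higuchi 2000, §2 p. 3).

## References

* H.-O. Georgii, Y. Higuchi, J. Math. Phys. 41 (2000) 1153–1169, §2, p. 3 [GeorgiiHiguchi2000].
* S. Friedli, Y. Velenik, *Statistical Mechanics of Lattice Systems*, CUP 2017, §3.1 and
  Exercise 6.21 [FriedliVelenik2017].
-/

noncomputable section

open MeasureTheory Finset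

namespace Literature.Probability.LatticeModels

variable {V : Type*}

/-! ### Relabelling configurations along a bijection of sites -/

/-- The action of a bijection `φ` of sites on spin configurations, `(configRelabel φ σ) y =
σ (φ⁻¹ y)`, as a measurable equivalence of `{±1}^V` (Georgii–Higuchi 2000, §2, p. 3: the lattice
transformations "act canonically on `Ω`"; Mathlib `MeasurableEquiv.arrowCongr'`). [cite: GeorgiiHiguchi2000, §2 p. 3] -/
def configRelabel (φ : V ≃ V) : SpinConfig V ≃ᵐ SpinConfig V :=
  MeasurableEquiv.arrowCongr' φ (MeasurableEquiv.refl ℤˣ)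

/-- `configRelabel φ σ = σ ∘ φ⁻¹`. [cite: GeorgiiHiguchi2000, §2 p. 3] -/
theorem configRelabel_eq_comp_symm (φ : V ≃ V) (σ : SpinConfig V) :
    configRelabel φ σ = σ ∘ φ.symm := rfl

/-- `(configRelabel φ σ) y = σ (φ⁻¹ y)`. [cite: GeorgiiHiguchi2000, §2 p. 3] -/
@[simp] theorem configRelabel_apply (φ : V ≃ V) (σ : SpinConfig V) (y : V) :
    configRelabel φ σ y = σ (φ.symm y) := rfl

/-- `(configRelabel φ σ) (φ x) = σ x`. [cite: GeorgiiHiguchi2000, §2 p. 3] -/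
@[simp] theorem configRelabel_apply_apply (φ : V ≃ V) (σ : SpinConfig V) (x : V) :
    configRelabel φ σ (φ x) = σ x := by
  simp

/-- The spin at `φ x` of the relabelled configuration is the spin at `x`. [cite: GeorgiiHiguchi2000, §2 p. 3] -/
@[simp] theorem spinAt_apply_configRelabel (φ : V ≃ V) (σ : SpinConfig V) (x : V) :
    spinAt (φ x) (configRelabel φ σ) = spinAt x σ := by
  simp [spinAt]

/-- Membership in the image volume: `y ∈ φ(Λ) ↔ φ⁻¹ y ∈ Λ`. [folklore] -/
theorem mem_map_toEmbedding_iff (φ : V ≃ V) (Λ : Finset V) (y : V) :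
    y ∈ Λ.map φ.toEmbedding ↔ φ.symm y ∈ Λ :=
  Finset.mem_map_equiv

/-! ### Covariance of the finite-volume objects under graph automorphisms -/

section FiniteVolume

variable (G : SimpleGraph V) [DecidableEq V] [G.LocallyFinite]

/-- The edges touching the image volume are the images of the edges touching the volume:
`ℰ^b_{φ(Λ)} = φ(ℰ^b_Λ)` for a graph automorphism `φ` (Friedli–Velenik 2017, §3.1). [cite: FriedliVelenik2017, §3.1] -/
theorem edgesTouching_map_iso (φ : G ≃g G) (Λ : Finset V) :
    edgesTouching G (Λ.map φ.toEquiv.toEmbedding) =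
      (edgesTouching G Λ).map ⟨Sym2.map φ, Sym2.map.injective φ.injective⟩ := by
  ext e
  rw [mem_edgesTouching_iff, Finset.mem_map]
  simp only [Function.Embedding.coeFn_mk]
  induction e using Sym2.ind with
  | _ a b =>
    constructor
    · rintro ⟨hadj, x, hx, hxe⟩
      rw [mem_map_toEmbedding_iff] at hx
      have hadj' : G.Adj (φ.symm a) (φ.symm b) :=
        (φ.symm.map_adj_iff).2 ((SimpleGraph.mem_edgeSet _).1 hadj)
      refine ⟨s(φ.symm a, φ.symm b), ?_, ?_⟩
      · rw [mem_edgesTouching_iff]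
        refine ⟨(SimpleGraph.mem_edgeSet _).2 hadj', φ.symm x, hx, ?_⟩
        rcases Sym2.mem_iff.1 hxe with rfl | rfl
        · exact Sym2.mem_mk_left _ _
        · exact Sym2.mem_mk_right _ _
      · rw [Sym2.map_mk]
        show s(φ (φ.symm a), φ (φ.symm b)) = s(a, b)
        rw [RelIso.apply_symm_apply, RelIso.apply_symm_apply]
    · rintro ⟨e₀, he₀, he⟩
      induction e₀ using Sym2.ind with
      | _ a₀ b₀ =>
        rw [mem_edgesTouching_iff] at he₀
        obtain ⟨hadj₀, x₀, hx₀, hx₀e⟩ := he₀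
        have hadj' : G.Adj (φ a₀) (φ b₀) := (φ.map_adj_iff).2 ((SimpleGraph.mem_edgeSet _).1 hadj₀)
        rw [Sym2.map_mk] at he
        rw [← he]
        refine ⟨(SimpleGraph.mem_edgeSet _).2 hadj', φ x₀, ?_, ?_⟩
        · rw [mem_map_toEmbedding_iff]
          show φ.toEquiv.symm (φ x₀) ∈ Λ
          rw [show φ.toEquiv.symm (φ x₀) = x₀ from φ.toEquiv.symm_apply_apply x₀]
          exact hx₀
        · rcases Sym2.mem_iff.1 hx₀e with rfl | rfl
          · exact Sym2.mem_mk_left _ _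
          · exact Sym2.mem_mk_right _ _

/-- **The fixed-boundary Hamiltonian is covariant**: `ℋ_{φ(Λ);h}(R_φ σ) = ℋ_{Λ;h}(σ)` for a graph
automorphism `φ` (the boundary condition does not enter the fixed-boundary Hamiltonian, only the
glued configuration) (Friedli–Velenik 2017, §3.1, eq. (3.6)). [cite: FriedliVelenik2017, §3.1] -/
theorem isingHamiltonian_fixed_relabel (φ : G ≃g G) (Λ : Finset V) (h : ℝ)
    (η η' : SpinConfig V) (σ : SpinConfig V) :
    isingHamiltonian G (Λ.map φ.toEquiv.toEmbedding) h (.fixed η') (configRelabel φ.toEquiv σ) =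
      isingHamiltonian G Λ h (.fixed η) σ := by
  have h1 : ∑ e ∈ (edgesTouching G Λ).map ⟨Sym2.map φ, Sym2.map.injective φ.injective⟩,
        bondSpin (configRelabel φ.toEquiv σ) e = ∑ e ∈ edgesTouching G Λ, bondSpin σ e := by
    simp only [Finset.sum_map, Function.Embedding.coeFn_mk]
    refine Finset.sum_congr rfl fun e _ => ?_
    induction e using Sym2.ind with
    | _ a b =>
      rw [Sym2.map_mk, bondSpin_mk, bondSpin_mk]
      exact congrArg₂ (· * ·) (spinAt_apply_configRelabel φ.toEquiv σ a)
        (spinAt_apply_configRelabel φ.toEquiv σ b)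
  have h2 : ∑ x ∈ Λ.map φ.toEquiv.toEmbedding, spinAt x (configRelabel φ.toEquiv σ) =
      ∑ x ∈ Λ, spinAt x σ := by
    simp only [Finset.sum_map, Equiv.coe_toEmbedding]
    exact Finset.sum_congr rfl fun x _ => spinAt_apply_configRelabel φ.toEquiv σ x
  simp only [isingHamiltonian, interactionEdges_fixed]
  rw [edgesTouching_map_iso, h1, h2]

/-- **Covariance of fixed-boundary expectations**: `⟨F⟩^{R_φ η}_{φ(Λ);β,h} = ⟨F ∘ R_φ⟩^{η}_{Λ;β,h}`
for measurable `F` and a graph automorphism `φ` (reindex the Boltzmann sum by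
`τ ↦ τ ∘ φ⁻¹`; Friedli–Velenik 2017, §3.1, eq. (3.8), and Exercise 6.21). [cite: FriedliVelenik2017, §3.1] -/
theorem isingExpect_fixed_relabel (φ : G ≃g G) (Λ : Finset V) (β h : ℝ) (η : SpinConfig V)
    {F : SpinConfig V → ℝ} (hF : Measurable F) :
    isingExpect G (Λ.map φ.toEquiv.toEmbedding) β h (.fixed (configRelabel φ.toEquiv η)) F =
      isingExpect G Λ β h (.fixed η) (F ∘ configRelabel φ.toEquiv) := by
  set Λ' := Λ.map φ.toEquiv.toEmbedding with hΛ'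
  set R := configRelabel φ.toEquiv with hR
  have hmem : ∀ {y : V}, y ∈ Λ' → φ.toEquiv.symm y ∈ Λ := fun hy => by
    rwa [hΛ', mem_map_toEmbedding_iff] at hy
  have hmem' : ∀ {x : V}, x ∈ Λ → φ.toEquiv x ∈ Λ' := fun {x} hx => by
    rw [hΛ', mem_map_toEmbedding_iff, Equiv.symm_apply_apply]
    exact hx
  let e : (Λ → ℤˣ) ≃ (Λ' → ℤˣ) :=
    { toFun := fun τ y => τ ⟨φ.toEquiv.symm y.1, hmem y.2⟩
      invFun := fun τ' x => τ' ⟨φ.toEquiv x.1, hmem' x.2⟩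
      left_inv := fun τ => funext fun x => by
        simp only
        congr 1
        exact Subtype.ext (φ.toEquiv.symm_apply_apply x.1)
      right_inv := fun τ' => funext fun y => by
        simp only
        congr 1
        exact Subtype.ext (φ.toEquiv.apply_symm_apply y.1) }
  have hglue : ∀ τ : Λ → ℤˣ, glue Λ' (e τ) (.fixed (R η)) = R (glue Λ τ (.fixed η)) := by
    intro τ
    funext y
    by_cases hy : y ∈ Λ'
    · rw [glue_apply_of_mem _ _ _ hy, hR, configRelabel_apply, glue_apply_of_mem _ _ _ (hmem hy)]
      rfl
    · have hy' : φ.toEquiv.symm y ∉ Λ := fun h' => hy (by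
        have := hmem' h'
        rwa [Equiv.apply_symm_apply] at this)
      rw [glue_apply_of_notMem _ _ _ hy, hR, BoundaryCondition.outside_fixed, configRelabel_apply,
        configRelabel_apply, glue_apply_of_notMem _ _ _ hy', BoundaryCondition.outside_fixed]
  have hw : ∀ τ : Λ → ℤˣ, isingWeight G Λ' β h (.fixed (R η)) (e τ) =
      isingWeight G Λ β h (.fixed η) τ := by
    intro τ
    rw [isingWeight, isingWeight, hglue, hΛ', hR, isingHamiltonian_fixed_relabel G φ Λ h η]
  have hFm : Measurable (F ∘ R) := hF.comp R.measurable
  rw [isingExpect_eq_sum_div _ _ _ _ β hF, isingExpect_eq_sum_div _ _ _ _ β hFm,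
    isingPartitionFunction, isingPartitionFunction, ← Equiv.sum_comp e, ← Equiv.sum_comp e]
  simp only [hw, hglue, Function.comp_apply]

/-- **Covariance of the finite-volume Gibbs measures**: `μ^{R_φ η}_{φ(Λ);β,h} = μ^η_{Λ;β,h} ∘ R_φ⁻¹`
(Friedli–Velenik 2017, Exercise 6.21: invariance of the Ising specification under lattice
symmetries). [cite: FriedliVelenik2017, §3.1] -/
theorem isingMeasure_fixed_map_relabel (φ : G ≃g G) (Λ : Finset V) (β h : ℝ) (η : SpinConfig V) :
    (isingMeasure G Λ β h (.fixed η)).map (configRelabel φ.toEquiv) =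
      isingMeasure G (Λ.map φ.toEquiv.toEmbedding) β h (.fixed (configRelabel φ.toEquiv η)) := by
  set R := configRelabel φ.toEquiv with hR
  haveI : IsProbabilityMeasure ((isingMeasure G Λ β h (.fixed η)).map R) :=
    Measure.isProbabilityMeasure_map R.measurable.aemeasurable
  ext A hA
  have hind : Measurable (A.indicator (1 : SpinConfig V → ℝ)) := measurable_one.indicator hA
  have h1 : ((isingMeasure G Λ β h (.fixed η)).map R).real A =
      (isingMeasure G (Λ.map φ.toEquiv.toEmbedding) β h (.fixed (R η))).real A := by
    rw [← integral_indicator_one hA, ← integral_indicator_one hA, integral_map_equiv]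
    have := isingExpect_fixed_relabel G φ Λ β h η hind
    simp only [isingExpect] at this
    rw [this]
    rfl
  rw [measureReal_def, measureReal_def, ENNReal.toReal_eq_toReal_iff' (measure_ne_top _ _)
    (measure_ne_top _ _)] at h1
  exact h1

/-- **Covariance of the Ising specification**: `γ_{φ(Λ)}(A | R_φ η) = γ_Λ(R_φ⁻¹ A | η)`. [cite: FriedliVelenik2017, §3.1] -/
theorem isingSpecification_relabel_apply (φ : G ≃g G) (β h : ℝ) (Λ : Finset V) (η : SpinConfig V)
    {A : Set (SpinConfig V)} (hA : MeasurableSet A) :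
    isingSpecification G β h (Λ.map φ.toEquiv.toEmbedding) (configRelabel φ.toEquiv η) A =
      isingSpecification G β h Λ η (configRelabel φ.toEquiv ⁻¹' A) := by
  rw [isingSpecification_apply, isingSpecification_apply, ← isingMeasure_fixed_map_relabel,
    Measure.map_apply (configRelabel φ.toEquiv).measurable hA]

variable [Countable V]

/-- **`𝒢(β, h)` is invariant under graph automorphisms** (Georgii–Higuchi 2000, §2, p. 3: the
lattice symmetries "preserve the Ising Hamiltonian, and thereby the class `𝒢` of Gibbs measures";
Georgii 2011, §5.1): if `μ` is a Gibbs measure for the Ising specification of `G`, so is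
`μ ∘ R_φ⁻¹`. Proof: for a volume `Λ'` write `Λ' = φ(Λ)` with `Λ = φ⁻¹(Λ')`; then
`∫ γ_{Λ'}(A|η') (μ∘R⁻¹)(dη') = ∫ γ_{φ(Λ)}(A | R η) μ(dη) = ∫ γ_Λ(R⁻¹A|η) μ(dη) = μ(R⁻¹ A)`. [cite: GeorgiiHiguchi2000, §2 p. 3] -/
theorem IsGibbsMeasure.map_configRelabel (φ : G ≃g G) {β h : ℝ} {μ : Measure (SpinConfig V)}
    (hμ : IsGibbsMeasure (isingSpecification G β h) μ) :
    IsGibbsMeasure (isingSpecification G β h) (μ.map (configRelabel φ.toEquiv)) := by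
  haveI := hμ.isProbabilityMeasure
  set R := configRelabel φ.toEquiv with hR
  have hγ : IsSpecification (isingSpecification G β h) := isSpecification_isingSpecification_holds G β h
  refine ⟨Measure.isProbabilityMeasure_map R.measurable.aemeasurable, fun Λ' A hA => ?_⟩
  -- `Λ' = φ(Λ)` with `Λ = φ⁻¹(Λ')`
  set Λ : Finset V := Λ'.map φ.symm.toEquiv.toEmbedding with hΛ
  have hΛ' : Λ' = Λ.map φ.toEquiv.toEmbedding := by
    rw [hΛ, Finset.map_map]
    have : φ.symm.toEquiv.toEmbedding.trans φ.toEquiv.toEmbedding = Function.Embedding.refl V := by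
      ext x
      exact φ.toEquiv.apply_symm_apply x
    rw [this, Finset.map_refl]
  rw [lintegral_map (hγ.measurable_coe Λ' hA) R.measurable, Measure.map_apply R.measurable hA]
  have hpt : ∀ η, isingSpecification G β h Λ' (R η) A =
      isingSpecification G β h Λ η (R ⁻¹' A) := fun η => by
    rw [hΛ', hR, isingSpecification_relabel_apply G φ β h Λ η hA]
  simp_rw [hpt]
  exact hμ.2 Λ (R ⁻¹' A) (R.measurable hA)

end FiniteVolume

end Literature.Probability.LatticeModels
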